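/-
Copyright: statement-level skeleton of a published paper (lit-balaban cell, Phase-2 proof seat p39 gen 3). No proof claims
beyond what the kernel checks below.
-/
import Mathlib.Analysis.SpecialFunctions.Gaussian.GaussianIntegral
import Mathlib.Analysis.SpecialFunctions.Trigonometric.Series
import Mathlib.Analysis.Complex.ExponentialBounds
import Mathlib.Analysis.Real.Pi.Bounds
import Mathlib.MeasureTheory.Integral.IntegralEqImproper
import Literature.MathematicalPhysics.QuantumFieldTheory.Balaban1983to89.B3CxiPoissonization

/-!
# B3 — T. Bałaban, *(Higgs)₂,₃ quantum fields in a finite volume. III. Renormalization*, CMP **88** (1983) 411–445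
[Balaban1983Higgs3], p. 437: the printed bound |C^ξ(y−y′)| ≤ O(1)e^{−½|y−y′|}/|y−y′| for the free propagator
C^ξ = (−Δ^ξ+1)^{−1} on ξℤ³, uniformly in the lattice spacing 0 < ξ ≤ 1 — FILE 3/3: ASSEMBLY (d = 3)

statement-level skeleton of published theorems with citation tags; proofs where landed; nothing here is a claim about
the Yang–Mills mass gap

PDF held: `paper:balaban1983-higgs-2-3-quantum-fields-finite-volume` (journal page = PDF page + 410), p. 437 [PDF 27].
WHAT IS REPRODUCED: the third of three files for row **B3.Eq3.11-3.17** of `HOME/lit-balaban-r15/ROWS-B3.md` (reader/typer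
r15, fold owner of B3) — the p. 437 sentence *"Using the inequalities |C^ξ(y − y′)| ≦ O(1)e^{−½|y−y′|}/|y − y′|,
|(∂^{ξ⁻¹}_ν M)(y, y′)| ≦ O(1)e^{−δ₀|y−y′|}/|y − y′|², we can estimate (3.16) by a constant"* — here the FIRST inequality, for
the free propagator C^ξ = (−Δ^ξ+1)^{−1} of the ξ-lattice (r15's `B3Sect3VectorSelfEnergy.Cxi 3 ξ y`, y ∈ ℤ³ the integer label
of the lattice point ξy, so that ξ|y| is the physical distance |y − y′| of the paper), PROVED WITH AN EXPLICIT CONSTANT AND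
UNIFORMLY IN THE LATTICE SPACING: **for 0 < ξ ≤ 1 and 0 ≠ y ∈ ℤ³, 0 ≤ C^ξ(y) ≤ 140·e^{−ξ|y|/2}/(ξ|y|)**, |y| = (Σ_μ y_μ²)^{1/2}
(`Cxi_three_le`, `abs_Cxi_three_le`; sup-norm form `Cxi_three_le_sup`, the shape `A(ξ·supDist)⁻¹e^{−δξ·supDist}` in which
`B3Bound316`/`B3Ineq313Pointwise` take this bound as a hypothesis, A = 140, δ = ½).  Unit `lit-balaban-p39-g3` (Phase-2 proof
seat p39, gen 3), HOME `run/shared/lean/pub/lit-balaban/`.  The paper refers the bound to its general propagator estimates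
((2.10)–(2.12) of [I]) and prints no proof; the proof here is the elementary heat-kernel one: by FILE 2 (`B3CxiPoissonization`,
`Cxi_eq_poissonK`) C^ξ(y) = θξ²ξ^{−3}∫₀^∞e^{−t}Π_μF(θt,|y_μ|)dt with θ = (6+ξ²)^{−1} and the one-dimensional kernel F of FILE 1
(`B3CxiBesselKernel`), whose tilted Poisson bound `besselF_le` F(s,n) ≤ 2(1+s)^{−1/2}e^{2s cosh a − an} (a ≥ 0) is used in two
regimes (§2): the Gaussian tilt a_μ = 5|y_μ|/(14s) when 5|y|_∞ ≤ 28s (cosh a − 1 ≤ (7/10)a² on [0,2], from the cosh power series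
and cosh 2 ≤ 19/5), giving Π_μF ≤ (2/√(1+s))³e^{6s − (5/28)|y|²/s}, and the tilt a = 2 on a largest coordinate otherwise, giving
Π_μF ≤ (2/√(1+s))³e^{6s − |y|_∞}; with e^{−t}e^{6θt} = e^{−ξ²θt} and ξ²u + (5/28)|y|²/u ≥ ξ|y|/2 + |y|²/(14u) (§3) the
t-integral is bounded (§4) by e^{−ξ|y|/2}·8θ^{−1}∫₀^∞u^{−3/2}e^{−(|y|²/14)/u}du = e^{−ξ|y|/2}·8θ^{−1}√(14π)/|y| (substitution
u = x^{−2} to Mathlib's `integral_gaussian_Ioi`) plus e^{−|y|_∞}∫₀^∞(2/√(1+θt))³dt = 16θ^{−1}e^{−|y|_∞}, and (§5)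
16e^{−|y|_∞} ≤ 16e^{−4|y|/7} ≤ (224/e)e^{−|y|/2}/|y| (|y| ≤ √3|y|_∞), 8√(14π) + 224/e ≤ 56 + 84 = 140.  The prefactor
θξ²ξ^{−3}·θ^{−1} = ξ^{−1} is what makes the bound uniform in ξ.  Mathlib + the cited tree files only; definitions with bodies
(`rsq`, `supNorm`); no named facts.
-/

open scoped BigOperators Topology
open Real MeasureTheory Set Filter

namespace Literature.MathematicalPhysics.QuantumFieldTheory.Balaban1983to89.B3CxiUniformBound

open B3Sect3VectorSelfEnergy B3CxiPropagator B3CxiBesselKernel B3CxiPoissonization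

noncomputable section

variable {d : ℕ} {ξ : ℝ}

/-! ## 1. Elementary inequalities: cosh on [0,2], the Gaussian tilt, completing the square -/

/-- kernel: cosh 2 ≤ 19/5 (numerical, from e < 2.7182818286). [folklore] -/
private theorem cosh_two_le : Real.cosh 2 ≤ 19 / 5 := by
  rw [Real.cosh_eq]
  have he := Real.exp_one_lt_d9
  have he' := Real.exp_one_gt_d9
  have h2 : Real.exp 2 = Real.exp 1 * Real.exp 1 := by rw [← Real.exp_add]; norm_num
  have hup : Real.exp 2 ≤ 7.3891 := by rw [h2]; nlinarith [Real.exp_pos 1]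
  have hlo : 7.389 ≤ Real.exp 2 := by rw [h2]; nlinarith [Real.exp_pos 1]
  have hneg : Real.exp (-2) ≤ 0.1354 := by
    rw [Real.exp_neg, inv_le_comm₀ (Real.exp_pos 2) (by norm_num)]
    exact le_trans (by norm_num) hlo
  linarith

/-- kernel: cosh a − 1 ≤ (a²/4)(cosh 2 − 1) for 0 ≤ a ≤ 2 — termwise comparison of the even power series
`Real.hasSum_cosh` (a^{2n} ≤ (a²/4)·2^{2n} for n ≥ 1). [folklore] -/
private theorem cosh_sub_one_le_sq_mul {a : ℝ} (h0 : 0 ≤ a) (h2 : a ≤ 2) :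
    Real.cosh a - 1 ≤ a ^ 2 / 4 * (Real.cosh 2 - 1) := by
  have ha := Real.hasSum_cosh a
  have hg : HasSum (fun n : ℕ => a ^ 2 / 4 * ((2 : ℝ) ^ (2 * n) / ↑(2 * n).factorial)
      + (if n = 0 then 1 - a ^ 2 / 4 else 0)) (a ^ 2 / 4 * Real.cosh 2 + (1 - a ^ 2 / 4)) :=
    ((Real.hasSum_cosh (2 : ℝ)).mul_left _).add (hasSum_ite_eq 0 _)
  have hle : ∀ n : ℕ, a ^ (2 * n) / ↑(2 * n).factorial ≤
      a ^ 2 / 4 * ((2 : ℝ) ^ (2 * n) / ↑(2 * n).factorial) + (if n = 0 then 1 - a ^ 2 / 4 else 0) := by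
    intro n
    rcases Nat.eq_zero_or_pos n with hn | hn
    · subst hn
      rw [if_pos rfl]
      simp only [mul_zero, pow_zero, Nat.factorial_zero, Nat.cast_one, div_one, mul_one]
      linarith
    · rw [if_neg hn.ne', add_zero]
      have hfac : (0 : ℝ) < ↑(2 * n).factorial := by positivity
      have key : a ^ (2 * n) ≤ a ^ 2 / 4 * (2 : ℝ) ^ (2 * n) := by
        obtain ⟨m, rfl⟩ : ∃ m, n = m + 1 := ⟨n - 1, by omega⟩
        have hm : a ^ (2 * m) ≤ (2 : ℝ) ^ (2 * m) := pow_le_pow_left₀ h0 h2 _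
        have e1 : a ^ (2 * (m + 1)) = a ^ (2 * m) * a ^ 2 := by ring
        have e2 : a ^ 2 / 4 * (2 : ℝ) ^ (2 * (m + 1)) = (2 : ℝ) ^ (2 * m) * a ^ 2 := by ring
        rw [e1, e2]
        exact mul_le_mul_of_nonneg_right hm (sq_nonneg a)
      calc a ^ (2 * n) / ↑(2 * n).factorial ≤ (a ^ 2 / 4 * (2 : ℝ) ^ (2 * n)) / ↑(2 * n).factorial :=
            div_le_div_of_nonneg_right key hfac.le
        _ = _ := by ring
  have := hasSum_le hle ha hg
  linarith

/-- kernel: cosh a − 1 ≤ (7/10)a² for 0 ≤ a ≤ 2 ((cosh 2 − 1)/4 ≈ 0.69). [folklore] -/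
private theorem cosh_sub_one_le {a : ℝ} (h0 : 0 ≤ a) (h2 : a ≤ 2) : Real.cosh a - 1 ≤ 7 / 10 * a ^ 2 := by
  have h := cosh_sub_one_le_sq_mul h0 h2
  have h' := mul_le_mul_of_nonneg_left (show Real.cosh 2 - 1 ≤ 14 / 5 by linarith [cosh_two_le])
    (by positivity : (0 : ℝ) ≤ a ^ 2 / 4)
  linarith

/-- kernel (the Gaussian tilt): for s > 0 and 0 ≤ n with 5n ≤ 28s, the tilt a = 5n/(14s) ∈ [0,2] gives
2s·cosh a − a·n ≤ 2s − (5/28)n²/s. [folklore] -/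
private theorem tilt_gauss {s n : ℝ} (hs : 0 < s) (hn : 0 ≤ n) (hns : 5 * n ≤ 28 * s) :
    2 * s * Real.cosh (5 * n / (14 * s)) - 5 * n / (14 * s) * n ≤ 2 * s - 5 / 28 * n ^ 2 / s := by
  set a := 5 * n / (14 * s) with ha
  have ha0 : 0 ≤ a := by positivity
  have ha2 : a ≤ 2 := by rw [ha, div_le_iff₀ (by positivity)]; linarith
  have hc := cosh_sub_one_le ha0 ha2
  have h1 := mul_le_mul_of_nonneg_left hc (by positivity : (0 : ℝ) ≤ 2 * s)
  have hs' := hs.ne'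
  have h2 : 2 * s * (7 / 10 * a ^ 2) - a * n = -(5 / 28 * n ^ 2 / s) := by
    rw [ha]; field_simp; ring
  linarith

/-- kernel (completing the square): x R/2 + R²/(14u) ≤ x²u + (5/28)R²/u for u > 0, because
x²u² − ½xRu + (3/28)R² = (xu − R/4)² + (5/112)R² ≥ 0. [folklore] -/
private theorem complete_square {u x R : ℝ} (hu : 0 < u) :
    x * R / 2 + R ^ 2 / (14 * u) ≤ x ^ 2 * u + 5 / 28 * R ^ 2 / u := by
  have hu' := hu.ne'
  have e : x ^ 2 * u + 5 / 28 * R ^ 2 / u - (x * R / 2 + R ^ 2 / (14 * u))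
      = ((x * u - R / 4) ^ 2 + 5 / 112 * R ^ 2) / u := by
    field_simp; ring
  have : 0 ≤ x ^ 2 * u + 5 / 28 * R ^ 2 / u - (x * R / 2 + R ^ 2 / (14 * u)) := by
    rw [e]; positivity
  linarith

/-- kernel: (2/√(1+u))³ ≤ 8u^{−3/2} for u > 0. [folklore] -/
private theorem pref_le_rpow {u : ℝ} (hu : 0 < u) : (2 / Real.sqrt (1 + u)) ^ 3 ≤ 8 * u ^ (-(3 / 2 : ℝ)) := by
  have hsu : 0 < Real.sqrt u := Real.sqrt_pos.mpr hu
  have hle : Real.sqrt u ≤ Real.sqrt (1 + u) := Real.sqrt_le_sqrt (by linarith)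
  have h1 : 2 / Real.sqrt (1 + u) ≤ 2 / Real.sqrt u := div_le_div_of_nonneg_left (by norm_num) hsu hle
  have h1' : (2 / Real.sqrt (1 + u)) ^ 3 ≤ (2 / Real.sqrt u) ^ 3 := pow_le_pow_left₀ (by positivity) h1 3
  have h2 : (2 / Real.sqrt u) ^ 3 = 8 * u ^ (-(3 / 2 : ℝ)) := by
    rw [div_pow, Real.rpow_neg hu.le, Real.sqrt_eq_rpow, ← Real.rpow_natCast (u ^ (1 / (2 : ℝ))) 3,
      ← Real.rpow_mul hu.le]
    norm_num [div_eq_mul_inv]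
  linarith [h2.le]

/-- kernel: R·e^{−4R/7} ≤ (14/e)·e^{−R/2} (x ≤ e^{x−1} with x = R/14). [folklore] -/
private theorem mul_exp_le {R : ℝ} :
    R * Real.exp (-(4 * R / 7)) ≤ 14 / Real.exp 1 * Real.exp (-(R / 2)) := by
  have h1 : R / 14 ≤ Real.exp (R / 14 - 1) := by linarith [Real.add_one_le_exp (R / 14 - 1)]
  have h2 : Real.exp (R / 14 - 1) = Real.exp (R / 14) / Real.exp 1 := by rw [Real.exp_sub]
  have h3 : Real.exp (-(4 * R / 7)) = Real.exp (-(R / 2)) / Real.exp (R / 14) := by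
    rw [← Real.exp_sub]; congr 1; ring
  have hpos := Real.exp_pos (R / 14)
  have hpos1 := Real.exp_pos (1 : ℝ)
  have hpos2 := Real.exp_pos (-(R / 2))
  rw [h2, le_div_iff₀ hpos1] at h1
  rw [h3]
  rw [mul_div_assoc', div_le_iff₀ hpos]
  calc R * Real.exp (-(R / 2)) = (R / 14 * Real.exp 1) * (14 / Real.exp 1 * Real.exp (-(R / 2))) := by
        field_simp
    _ ≤ Real.exp (R / 14) * (14 / Real.exp 1 * Real.exp (-(R / 2))) :=
        mul_le_mul_of_nonneg_right h1 (by positivity)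
    _ = _ := by ring

/-- R²(y) = Σ_μ |y_μ|², the squared Euclidean length of y ∈ ℤ^d in lattice units. [cite: Balaban1983Higgs3, (3.16) p.437] -/
def rsq (y : ZSite d) : ℝ := ∑ μ, ((y μ).natAbs : ℝ) ^ 2

/-- kernel: R²(y) ≥ 0. [cite: Balaban1983Higgs3, (3.16) p.437] -/
theorem rsq_nonneg (y : ZSite d) : 0 ≤ rsq y := Finset.sum_nonneg fun _ _ => sq_nonneg _

/-- kernel: R²(y) = Σ_μ y_μ² with the integer coordinates cast to ℝ. [cite: Balaban1983Higgs3, (3.16) p.437] -/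
theorem rsq_eq (y : ZSite d) : rsq y = ∑ μ, ((y μ : ℤ) : ℝ) ^ 2 := by
  unfold rsq
  refine Finset.sum_congr rfl fun μ _ => ?_
  rw [Nat.cast_natAbs, Int.cast_abs, sq_abs]

/-- kernel: R²(y) ≤ d·|y_{μ₀}|² for a largest coordinate μ₀. [cite: Balaban1983Higgs3, (3.16) p.437] -/
theorem rsq_le (y : ZSite d) (μ₀ : Fin d) (hmax : ∀ μ, (y μ).natAbs ≤ (y μ₀).natAbs) :
    rsq y ≤ d * ((y μ₀).natAbs : ℝ) ^ 2 := by
  unfold rsq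
  calc ∑ μ, ((y μ).natAbs : ℝ) ^ 2 ≤ ∑ _μ : Fin d, ((y μ₀).natAbs : ℝ) ^ 2 :=
        Finset.sum_le_sum fun μ _ => by
          have : ((y μ).natAbs : ℝ) ≤ ((y μ₀).natAbs : ℝ) := by exact_mod_cast hmax μ
          exact pow_le_pow_left₀ (Nat.cast_nonneg _) this 2
    _ = _ := by rw [Finset.sum_const, Finset.card_univ, Fintype.card_fin, nsmul_eq_mul]

/-- kernel: y ≠ 0 ⇒ a largest coordinate has modulus ≥ 1. [cite: Balaban1983Higgs3, (3.16) p.437] -/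
theorem one_le_max (y : ZSite d) (hy : y ≠ 0) (μ₀ : Fin d) (hmax : ∀ μ, (y μ).natAbs ≤ (y μ₀).natAbs) :
    1 ≤ ((y μ₀).natAbs : ℝ) := by
  obtain ⟨μ, hμ⟩ : ∃ μ, y μ ≠ 0 := by
    by_contra h
    push Not at h
    exact hy (funext h)
  have h1 : 1 ≤ (y μ).natAbs := Nat.one_le_iff_ne_zero.mpr (Int.natAbs_ne_zero.mpr hμ)
  exact_mod_cast h1.trans (hmax μ)

/-- kernel: |y_μ|² ≤ R²(y) for every coordinate μ. [cite: Balaban1983Higgs3, (3.16) p.437] -/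
theorem sq_le_rsq (y : ZSite d) (μ : Fin d) : ((y μ).natAbs : ℝ) ^ 2 ≤ rsq y := by
  unfold rsq
  exact Finset.single_le_sum (fun ν _ => sq_nonneg (((y ν).natAbs : ℝ))) (Finset.mem_univ μ)

/-! ## 2. The separated kernel with tilts: Q(s)(y) ≤ (2/√(1+s))^d exp(Σ_μ (2s cosh a_μ − a_μ|y_μ|)) and the two regimes -/

/-- kernel: Q(s)(y) ≤ (2/√(1+s))^d·exp(Σ_μ (2s cosh a_μ − a_μ|y_μ|)) for tilts a_μ ≥ 0 (`besselF_le` coordinatewise).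
[cite: Balaban1983Higgs3, (3.16) p.437] -/
theorem Q_le_tilt {s : ℝ} (hs : 0 ≤ s) (y : ZSite d) (a : Fin d → ℝ) (ha : ∀ μ, 0 ≤ a μ) :
    Q s y ≤ (2 / Real.sqrt (1 + s)) ^ d *
      Real.exp (∑ μ, (2 * s * Real.cosh (a μ) - a μ * ((y μ).natAbs : ℝ))) := by
  unfold Q
  calc ∏ μ, G s (y μ)
      ≤ ∏ μ, (2 / Real.sqrt (1 + s) * Real.exp (2 * s * Real.cosh (a μ) - a μ * ((y μ).natAbs : ℝ))) :=
        Finset.prod_le_prod (fun μ _ => G_nonneg hs _) (fun μ _ => besselF_le hs (ha μ) _)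
    _ = _ := by
        rw [Finset.prod_mul_distrib, Finset.prod_const, Finset.card_univ, Fintype.card_fin, Real.exp_sum]

/-- kernel (Gaussian regime): if 5|y_μ| ≤ 28s for all μ (s > 0), the tilts a_μ = 5|y_μ|/(14s) give
Σ_μ (2s cosh a_μ − a_μ|y_μ|) ≤ 2ds − (5/28)(Σ_μ|y_μ|²)/s. [cite: Balaban1983Higgs3, (3.16) p.437] -/
theorem sum_tilt_gauss {s : ℝ} (hs : 0 < s) (y : ZSite d) (h : ∀ μ, 5 * ((y μ).natAbs : ℝ) ≤ 28 * s) :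
    ∑ μ, (2 * s * Real.cosh (5 * ((y μ).natAbs : ℝ) / (14 * s))
        - 5 * ((y μ).natAbs : ℝ) / (14 * s) * ((y μ).natAbs : ℝ))
      ≤ 2 * d * s - 5 / 28 * rsq y / s := by
  calc _ ≤ ∑ μ : Fin d, (2 * s - 5 / 28 * ((y μ).natAbs : ℝ) ^ 2 / s) :=
        Finset.sum_le_sum fun μ _ => tilt_gauss hs (Nat.cast_nonneg _) (h μ)
    _ = 2 * d * s - 5 / 28 * rsq y / s := by
        simp only [rsq, Finset.sum_sub_distrib, Finset.sum_const, Finset.card_univ, Fintype.card_fin, nsmul_eq_mul,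
          Finset.mul_sum, Finset.sum_div]
        ring

/-- kernel (large-coordinate regime): if 28s < 5|y_{μ₀}| (s ≥ 0), the tilt a = 2 at μ₀ and 0 elsewhere gives
Σ_μ (2s cosh a_μ − a_μ|y_μ|) ≤ 2ds − |y_{μ₀}|. [cite: Balaban1983Higgs3, (3.16) p.437] -/
theorem sum_tilt_max {s : ℝ} (hs : 0 ≤ s) (y : ZSite d) (μ₀ : Fin d) (h : 28 * s < 5 * ((y μ₀).natAbs : ℝ)) :
    ∑ μ, (2 * s * Real.cosh (if μ = μ₀ then 2 else 0) - (if μ = μ₀ then 2 else 0) * ((y μ).natAbs : ℝ))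
      ≤ 2 * d * s - ((y μ₀).natAbs : ℝ) := by
  have hsplit : ∀ μ, (2 * s * Real.cosh (if μ = μ₀ then 2 else 0) - (if μ = μ₀ then 2 else 0) * ((y μ).natAbs : ℝ))
      = 2 * s + (if μ = μ₀ then (2 * s * (Real.cosh 2 - 1) - 2 * ((y μ₀).natAbs : ℝ)) else 0) := by
    intro μ
    split_ifs with hμ
    · rw [hμ]; ring
    · simp [Real.cosh_zero]
  rw [Finset.sum_congr rfl fun μ _ => hsplit μ, Finset.sum_add_distrib, Finset.sum_const, Finset.card_univ,
    Fintype.card_fin, nsmul_eq_mul, Finset.sum_ite_eq' Finset.univ μ₀, if_pos (Finset.mem_univ _)]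
  have h' := mul_le_mul_of_nonneg_left (show Real.cosh 2 - 1 ≤ 14 / 5 by linarith [cosh_two_le])
    (by positivity : (0 : ℝ) ≤ 2 * s)
  linarith

/-- kernel (both regimes, d = 3): for s > 0, y ∈ ℤ³ and μ₀ a largest coordinate,
Q(s)(y) ≤ (2/√(1+s))³·(exp(6s − (5/28)R²(y)/s) + exp(6s − |y_{μ₀}|)). [cite: Balaban1983Higgs3, (3.16) p.437] -/
theorem Q_three_le {s : ℝ} (hs : 0 < s) (y : ZSite 3) (μ₀ : Fin 3) (hmax : ∀ μ, (y μ).natAbs ≤ (y μ₀).natAbs) :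
    Q s y ≤ (2 / Real.sqrt (1 + s)) ^ 3 *
      (Real.exp (6 * s - 5 / 28 * rsq y / s) + Real.exp (6 * s - ((y μ₀).natAbs : ℝ))) := by
  have hpref : 0 ≤ (2 / Real.sqrt (1 + s)) ^ 3 := by positivity
  rcases le_or_gt (5 * ((y μ₀).natAbs : ℝ)) (28 * s) with h1 | h2
  · have hall : ∀ μ, 5 * ((y μ).natAbs : ℝ) ≤ 28 * s := fun μ => by
      have : ((y μ).natAbs : ℝ) ≤ ((y μ₀).natAbs : ℝ) := by exact_mod_cast hmax μ
      linarith
    have hQ : Q s y ≤ (2 / Real.sqrt (1 + s)) ^ 3 * Real.exp (∑ μ, (2 * s * Real.cosh (5 * ((y μ).natAbs : ℝ) / (14 * s))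
        - 5 * ((y μ).natAbs : ℝ) / (14 * s) * ((y μ).natAbs : ℝ))) :=
      Q_le_tilt hs.le y (fun μ => 5 * ((y μ).natAbs : ℝ) / (14 * s)) (fun μ => by positivity)
    have hE := sum_tilt_gauss hs y hall
    push_cast at hE
    calc Q s y ≤ _ := hQ
      _ ≤ (2 / Real.sqrt (1 + s)) ^ 3 * Real.exp (6 * s - 5 / 28 * rsq y / s) := by
          refine mul_le_mul_of_nonneg_left (Real.exp_le_exp.mpr ?_) hpref
          linarith
      _ ≤ _ := by
          refine mul_le_mul_of_nonneg_left ?_ hpref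
          linarith [Real.exp_pos (6 * s - ((y μ₀).natAbs : ℝ))]
  · have hQ : Q s y ≤ (2 / Real.sqrt (1 + s)) ^ 3 * Real.exp (∑ μ, (2 * s * Real.cosh (if μ = μ₀ then 2 else 0)
        - (if μ = μ₀ then 2 else 0) * ((y μ).natAbs : ℝ))) :=
      Q_le_tilt hs.le y (fun μ => if μ = μ₀ then 2 else 0) (fun μ => by split_ifs <;> norm_num)
    have hE := sum_tilt_max hs.le y μ₀ h2
    push_cast at hE
    calc Q s y ≤ _ := hQ
      _ ≤ (2 / Real.sqrt (1 + s)) ^ 3 * Real.exp (6 * s - ((y μ₀).natAbs : ℝ)) := by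
          refine mul_le_mul_of_nonneg_left (Real.exp_le_exp.mpr ?_) hpref
          linarith
      _ ≤ _ := by
          refine mul_le_mul_of_nonneg_left ?_ hpref
          linarith [Real.exp_pos (6 * s - 5 / 28 * rsq y / s)]

/-! ## 3. Pointwise bound for the Poissonized integrand on ξℤ³ -/

/-- kernel: θ = (6+ξ²)^{−1} > 0. [folklore] -/
private theorem theta3_pos (hξ : 0 < ξ) : 0 < hopWeight 3 ξ := by
  unfold hopWeight; positivity

/-- kernel: 6θ = 1 − θξ² for θ = (6+ξ²)^{−1} (so e^{−t}e^{6θt} = e^{−ξ²·θt}). [folklore] -/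
private theorem six_theta3 (hξ : 0 < ξ) : 6 * hopWeight 3 ξ = 1 - hopWeight 3 ξ * ξ ^ 2 := by
  have h : hopWeight 3 ξ * (2 * ((3 : ℕ) : ℝ) + ξ ^ 2) = 1 := by
    unfold hopWeight; exact inv_mul_cancel₀ (by positivity)
  push_cast at h
  linarith

/-- kernel: for t > 0, y ∈ ℤ³, μ₀ a largest coordinate, R² = Σ|y_μ|², R = √R², N = |y_{μ₀}|, θ = (6+ξ²)^{−1}:
e^{−t}Q(θt)(y) ≤ e^{−ξR/2}·8(θt)^{−3/2}e^{−(R²/14)/(θt)} + e^{−N}·(2/√(1+θt))³ — the two regimes of `Q_three_le`,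
e^{−t+6θt} = e^{−ξ²θt}, completing the square ξ²u + (5/28)R²/u ≥ ξR/2 + R²/(14u), and (2/√(1+u))³ ≤ 8u^{−3/2}.
[cite: Balaban1983Higgs3, (3.16) p.437] -/
theorem integrand_three_le (hξ : 0 < ξ) (y : ZSite 3) (μ₀ : Fin 3)
    (hmax : ∀ μ, (y μ).natAbs ≤ (y μ₀).natAbs) {t : ℝ} (ht : 0 < t) :
    integrand 3 ξ y t ≤
      Real.exp (-(ξ * Real.sqrt (rsq y) / 2)) *
          (8 * ((hopWeight 3 ξ * t) ^ (-(3 / 2 : ℝ)) * Real.exp (-(rsq y / 14) / (hopWeight 3 ξ * t))))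
        + Real.exp (-((y μ₀).natAbs : ℝ)) * (2 / Real.sqrt (1 + hopWeight 3 ξ * t)) ^ 3 := by
  have hθ : 0 < hopWeight 3 ξ := theta3_pos hξ
  have h6 := six_theta3 hξ
  have hs : 0 < hopWeight 3 ξ * t := mul_pos hθ ht
  have hQ := Q_three_le hs y μ₀ hmax
  have hR2 : Real.sqrt (rsq y) ^ 2 = rsq y := Real.sq_sqrt (rsq_nonneg y)
  have hcs := complete_square (x := ξ) (R := Real.sqrt (rsq y)) hs
  rw [hR2] at hcs
  have hp := pref_le_rpow hs
  unfold integrand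
  set s := hopWeight 3 ξ * t with hsdef
  set R := Real.sqrt (rsq y) with hRdef
  set N : ℝ := ((y μ₀).natAbs : ℝ) with hNdef
  have hexp : -t + 6 * s = -(ξ ^ 2 * s) := by
    rw [hsdef]
    have : -t + 6 * (hopWeight 3 ξ * t) = -((1 - 6 * hopWeight 3 ξ) * t) := by ring
    rw [this, h6]; ring
  have hpref : 0 ≤ (2 / Real.sqrt (1 + s)) ^ 3 := by positivity
  calc Real.exp (-t) * Q s y
      ≤ Real.exp (-t) * ((2 / Real.sqrt (1 + s)) ^ 3 *
          (Real.exp (6 * s - 5 / 28 * rsq y / s) + Real.exp (6 * s - N))) :=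
        mul_le_mul_of_nonneg_left hQ (Real.exp_pos _).le
    _ = (2 / Real.sqrt (1 + s)) ^ 3 *
          (Real.exp (-(ξ ^ 2 * s) - 5 / 28 * rsq y / s) + Real.exp (-(ξ ^ 2 * s) - N)) := by
        have e1 : Real.exp (-t) * Real.exp (6 * s - 5 / 28 * rsq y / s)
            = Real.exp (-(ξ ^ 2 * s) - 5 / 28 * rsq y / s) := by
          rw [← Real.exp_add]; congr 1; linarith
        have e2 : Real.exp (-t) * Real.exp (6 * s - N) = Real.exp (-(ξ ^ 2 * s) - N) := by
          rw [← Real.exp_add]; congr 1; linarith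
        rw [← e1, ← e2]; ring
    _ ≤ (2 / Real.sqrt (1 + s)) ^ 3 *
          (Real.exp (-(ξ * R / 2)) * Real.exp (-(rsq y / 14) / s) + Real.exp (-N)) := by
        refine mul_le_mul_of_nonneg_left (add_le_add ?_ ?_) hpref
        · rw [← Real.exp_add]
          refine Real.exp_le_exp.mpr ?_
          have e3 : -(rsq y / 14) / s = -(rsq y / (14 * s)) := by rw [neg_div, div_div]
          rw [e3]
          linarith
        · refine Real.exp_le_exp.mpr ?_
          have : 0 ≤ ξ ^ 2 * s := by positivity
          linarith
    _ ≤ _ := by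
        have hAB : 0 ≤ Real.exp (-(ξ * R / 2)) * Real.exp (-(rsq y / 14) / s) := by positivity
        have h1 := mul_le_mul_of_nonneg_left hp hAB
        have h2 : 0 ≤ (2 / Real.sqrt (1 + s)) ^ 3 * Real.exp (-N) := by positivity
        linarith

/-! ## 4. The two t-integrals: ∫₀^∞ (2/√(1+θt))³ dt = 16/θ and ∫₀^∞ u^{−3/2}e^{−q/u} du = √(π/q) -/

/-- kernel: −16/(θ√(1+θt)) is an antiderivative of (2/√(1+θt))³ on t ≥ 0 with limit 0 at ∞, hence
∫₀^∞ (2/√(1+θt))³ dt = 16/θ and the integrand is integrable (θ > 0). [cite: Balaban1983Higgs3, (3.16) p.437] -/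
theorem integral_pref {θ : ℝ} (hθ : 0 < θ) :
    IntegrableOn (fun t : ℝ => (2 / Real.sqrt (1 + θ * t)) ^ 3) (Ioi 0) ∧
    ∫ t in Ioi (0 : ℝ), (2 / Real.sqrt (1 + θ * t)) ^ 3 = 16 / θ := by
  have hθ' := hθ.ne'
  have hderiv : ∀ t ∈ Ici (0 : ℝ),
      HasDerivAt (fun x : ℝ => -16 / θ * (Real.sqrt (1 + θ * x))⁻¹) ((2 / Real.sqrt (1 + θ * t)) ^ 3) t := by
    intro t ht
    have hw : 0 < 1 + θ * t := by have : 0 ≤ θ * t := mul_nonneg hθ.le ht; linarith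
    have hsw : 0 < Real.sqrt (1 + θ * t) := Real.sqrt_pos.mpr hw
    have hsw' := hsw.ne'
    have h1 : HasDerivAt (fun x : ℝ => 1 + θ * x) θ t := by
      simpa using ((hasDerivAt_id t).const_mul θ).const_add 1
    have h3 := ((h1.sqrt hw.ne').inv hsw.ne').const_mul (-16 / θ)
    refine h3.congr_deriv ?_
    field_simp
    ring
  have hlim : Tendsto (fun x : ℝ => -16 / θ * (Real.sqrt (1 + θ * x))⁻¹) atTop (𝓝 0) := by
    have h1 : Tendsto (fun x : ℝ => 1 + θ * x) atTop atTop :=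
      tendsto_atTop_add_const_left _ _ (Tendsto.const_mul_atTop hθ tendsto_id)
    have h2 : Tendsto (fun x : ℝ => Real.sqrt (1 + θ * x)) atTop atTop := Real.tendsto_sqrt_atTop.comp h1
    have h3 := (h2.inv_tendsto_atTop).const_mul (-16 / θ)
    simpa using h3
  have hpos : ∀ t ∈ Ioi (0 : ℝ), 0 ≤ (2 / Real.sqrt (1 + θ * t)) ^ 3 := fun t _ => by positivity
  refine ⟨integrableOn_Ioi_deriv_of_nonneg' hderiv hpos hlim, ?_⟩
  rw [integral_Ioi_of_hasDerivAt_of_nonneg' hderiv hpos hlim, mul_zero, add_zero, Real.sqrt_one, inv_one, mul_one]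
  ring

/-- kernel: the substitution u = x^{−2}: (|−2|x^{−3})·(u^{−3/2}e^{−q/u})|_{u = x^{−2}} = 2e^{−qx²} for x > 0. [cite: Balaban1983Higgs3, (3.16) p.437] -/
theorem subst_identity (q : ℝ) {x : ℝ} (hx : 0 < x) :
    (|(-2 : ℝ)| * x ^ ((-2 : ℝ) - 1)) • ((x ^ (-2 : ℝ)) ^ (-(3 / 2 : ℝ)) * Real.exp (-q / x ^ (-2 : ℝ)))
      = 2 * Real.exp (-q * x ^ 2) := by
  have h1 : (x ^ (-2 : ℝ)) ^ (-(3 / 2 : ℝ)) = x ^ (3 : ℝ) := by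
    rw [← Real.rpow_mul hx.le]; norm_num
  have h2 : x ^ ((-2 : ℝ) - 1) * x ^ (3 : ℝ) = 1 := by
    rw [← Real.rpow_add hx]; norm_num
  have h3 : x ^ (-2 : ℝ) = (x ^ 2)⁻¹ := by
    rw [Real.rpow_neg hx.le, Real.rpow_two]
  rw [smul_eq_mul, h1, h3, abs_of_neg (by norm_num : (-2 : ℝ) < 0), neg_neg, div_inv_eq_mul]
  calc 2 * x ^ ((-2 : ℝ) - 1) * (x ^ (3 : ℝ) * Real.exp (-q * x ^ 2))
      = 2 * (x ^ ((-2 : ℝ) - 1) * x ^ (3 : ℝ)) * Real.exp (-q * x ^ 2) := by ring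
    _ = 2 * Real.exp (-q * x ^ 2) := by rw [h2, mul_one]

/-- kernel: ∫₀^∞ u^{−3/2}e^{−q/u} du = √(π/q) for q > 0 (substitution u = x^{−2} to Mathlib's Gaussian integral
`integral_gaussian_Ioi`), and the integrand is integrable on (0,∞). [cite: Balaban1983Higgs3, (3.16) p.437] -/
theorem integral_rpow_exp {q : ℝ} (hq : 0 < q) :
    IntegrableOn (fun u : ℝ => u ^ (-(3 / 2 : ℝ)) * Real.exp (-q / u)) (Ioi 0) ∧
    ∫ u in Ioi (0 : ℝ), u ^ (-(3 / 2 : ℝ)) * Real.exp (-q / u) = Real.sqrt (π / q) := by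
  set g : ℝ → ℝ := fun u => u ^ (-(3 / 2 : ℝ)) * Real.exp (-q / u) with hg
  have hcongr : EqOn (fun x : ℝ => (|(-2 : ℝ)| * x ^ ((-2 : ℝ) - 1)) • g (x ^ (-2 : ℝ)))
      (fun x => 2 * Real.exp (-q * x ^ 2)) (Ioi 0) := fun x hx => subst_identity q hx
  have hGauss : IntegrableOn (fun x : ℝ => 2 * Real.exp (-q * x ^ 2)) (Ioi 0) :=
    ((integrable_exp_neg_mul_sq hq).const_mul 2).integrableOn
  have hint : IntegrableOn g (Ioi 0) := by
    rw [← integrableOn_Ioi_comp_rpow_iff g (p := -2) (by norm_num)]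
    exact hGauss.congr_fun hcongr.symm measurableSet_Ioi
  refine ⟨hint, ?_⟩
  rw [← integral_comp_rpow_Ioi g (p := -2) (by norm_num), setIntegral_congr_fun measurableSet_Ioi hcongr,
    integral_const_mul, integral_gaussian_Ioi q]
  ring

/-! ## 5. Assembly: 0 ≤ C^ξ(y) ≤ 140·e^{−ξ|y|/2}/(ξ|y|) on ξℤ³, uniformly in 0 < ξ ≤ 1 -/

/-- kernel: the t-integral of the Poissonized integrand on ξℤ³ (y ≠ 0, μ₀ a largest coordinate, θ = (6+ξ²)^{−1}):
∫₀^∞ e^{−t}Q(θt)(y) dt ≤ e^{−ξR/2}·8θ^{−1}√(π/(R²/14)) + e^{−|y_{μ₀}|}·16/θ. [cite: Balaban1983Higgs3, (3.16) p.437] -/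
theorem integral_integrand_three_le (hξ : 0 < ξ) (y : ZSite 3) (hy : y ≠ 0) (μ₀ : Fin 3)
    (hmax : ∀ μ, (y μ).natAbs ≤ (y μ₀).natAbs) :
    ∫ t in Ioi (0 : ℝ), integrand 3 ξ y t ≤
      Real.exp (-(ξ * Real.sqrt (rsq y) / 2)) * (8 * ((hopWeight 3 ξ)⁻¹ * Real.sqrt (π / (rsq y / 14))))
        + Real.exp (-((y μ₀).natAbs : ℝ)) * (16 / hopWeight 3 ξ) := by
  have hθ : 0 < hopWeight 3 ξ := theta3_pos hξ
  have hN1 : 1 ≤ ((y μ₀).natAbs : ℝ) := one_le_max y hy μ₀ hmax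
  have hq : 0 < rsq y / 14 := by
    have h1 : (1 : ℝ) ≤ ((y μ₀).natAbs : ℝ) ^ 2 := by nlinarith
    linarith [sq_le_rsq y μ₀]
  obtain ⟨hgint, hgval⟩ := integral_rpow_exp hq
  obtain ⟨hAint, hAval⟩ := integral_pref hθ
  set g : ℝ → ℝ := fun u => u ^ (-(3 / 2 : ℝ)) * Real.exp (-(rsq y / 14) / u) with hgdef
  have hBint : IntegrableOn (fun t => g (hopWeight 3 ξ * t)) (Ioi 0) := by
    have h := (integrableOn_Ioi_comp_mul_left_iff g 0 hθ).mpr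
    rw [mul_zero] at h
    exact h hgint
  have hBval : ∫ t in Ioi (0 : ℝ), g (hopWeight 3 ξ * t) = (hopWeight 3 ξ)⁻¹ * Real.sqrt (π / (rsq y / 14)) := by
    have h := integral_comp_mul_left_Ioi g 0 hθ
    rw [mul_zero, smul_eq_mul] at h
    rw [h, hgval]
  have hpt : ∀ t ∈ Ioi (0 : ℝ), integrand 3 ξ y t ≤
      Real.exp (-(ξ * Real.sqrt (rsq y) / 2)) * (8 * g (hopWeight 3 ξ * t))
        + Real.exp (-((y μ₀).natAbs : ℝ)) * (2 / Real.sqrt (1 + hopWeight 3 ξ * t)) ^ 3 :=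
    fun t ht => integrand_three_le hξ y μ₀ hmax ht
  have hB8 : IntegrableOn (fun t => Real.exp (-(ξ * Real.sqrt (rsq y) / 2)) * (8 * g (hopWeight 3 ξ * t))) (Ioi 0) :=
    Integrable.const_mul (Integrable.const_mul hBint 8) _
  have hA' : IntegrableOn (fun t => Real.exp (-((y μ₀).natAbs : ℝ)) * (2 / Real.sqrt (1 + hopWeight 3 ξ * t)) ^ 3)
      (Ioi 0) := Integrable.const_mul hAint _
  calc ∫ t in Ioi (0 : ℝ), integrand 3 ξ y t
      ≤ ∫ t in Ioi (0 : ℝ), (Real.exp (-(ξ * Real.sqrt (rsq y) / 2)) * (8 * g (hopWeight 3 ξ * t))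
          + Real.exp (-((y μ₀).natAbs : ℝ)) * (2 / Real.sqrt (1 + hopWeight 3 ξ * t)) ^ 3) :=
        setIntegral_mono_on (integrableOn_integrand hξ y) (Integrable.fun_add hB8 hA') measurableSet_Ioi hpt
    _ = _ := by
        rw [integral_add hB8 hA', integral_const_mul, integral_const_mul, integral_const_mul, hBval, hAval]

/-- **p. 437 — the printed kernel bound for C^ξ = (−Δ^ξ+1)^{−1} on ξℤ³, uniformly in the lattice spacing**:
for 0 < ξ ≤ 1 and 0 ≠ y ∈ ℤ³, C^ξ(y) ≤ 140·e^{−ξ|y|/2}/(ξ|y|) with |y| = (Σ_μ y_μ²)^{1/2}, ξ|y| being the physical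
distance |y − y′| of the paper («|C^ξ(y − y′)| ≦ O(1)e^{−½|y−y′|}/|y − y′|», O(1) = 140); C^ξ ≥ 0 is r15's `Cxi_nonneg`.
[cite: Balaban1983Higgs3, (3.16) p.437] -/
theorem Cxi_three_le (hξ : 0 < ξ) (hξ1 : ξ ≤ 1) (y : ZSite 3) (hy : y ≠ 0) :
    Cxi 3 ξ y ≤ 140 * Real.exp (-(ξ * Real.sqrt (∑ μ, ((y μ : ℤ) : ℝ) ^ 2) / 2))
      / (ξ * Real.sqrt (∑ μ, ((y μ : ℤ) : ℝ) ^ 2)) := by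
  obtain ⟨μ₀, -, hmax⟩ := Finset.exists_max_image Finset.univ (fun μ => (y μ).natAbs) Finset.univ_nonempty
  have hmax' : ∀ μ, (y μ).natAbs ≤ (y μ₀).natAbs := fun μ => hmax μ (Finset.mem_univ μ)
  rw [← rsq_eq]
  have hθ : 0 < hopWeight 3 ξ := theta3_pos hξ
  have hθ' := hθ.ne'
  have hξ' := hξ.ne'
  have hI := integral_integrand_three_le hξ y hy μ₀ hmax'
  have hR2 : Real.sqrt (rsq y) ^ 2 = rsq y := Real.sq_sqrt (rsq_nonneg y)
  set R := Real.sqrt (rsq y) with hRdef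
  set N : ℝ := ((y μ₀).natAbs : ℝ) with hNdef
  have hN1 : 1 ≤ N := one_le_max y hy μ₀ hmax'
  have hRle : rsq y ≤ 3 * N ^ 2 := by have := rsq_le y μ₀ hmax'; push_cast at this; linarith
  have hRpos : 0 < R := by
    rw [hRdef]; exact Real.sqrt_pos.mpr (by nlinarith [sq_le_rsq y μ₀])
  have hR' := hRpos.ne'
  have h47 : 4 * R ≤ 7 * N := by
    have hsum : 0 < 4 * R + 7 * N := by linarith
    nlinarith [hsum, hR2, hRle, sq_nonneg N]
  have hsq : Real.sqrt (π / (rsq y / 14)) = Real.sqrt (14 * π) / R := by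
    rw [← hR2, show π / (R ^ 2 / 14) = 14 * π / R ^ 2 by rw [div_div_eq_mul_div]; ring,
      Real.sqrt_div' _ (sq_nonneg R), Real.sqrt_sq hRpos.le]
  have h14pi : Real.sqrt (14 * π) ≤ 7 :=
    calc Real.sqrt (14 * π) ≤ Real.sqrt (7 ^ 2) := Real.sqrt_le_sqrt (by nlinarith [Real.pi_lt_d2])
      _ = 7 := Real.sqrt_sq (by norm_num)
  rw [Cxi_eq_poissonK hξ y]
  unfold poissonK
  have hc : 0 ≤ hopWeight 3 ξ * ξ ^ 2 * ξ⁻¹ ^ 3 :=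
    mul_nonneg (mul_nonneg hθ.le (sq_nonneg ξ)) (pow_nonneg (inv_pos.mpr hξ).le 3)
  calc hopWeight 3 ξ * ξ ^ 2 * ξ⁻¹ ^ 3 * ∫ t in Ioi (0 : ℝ), integrand 3 ξ y t
      ≤ hopWeight 3 ξ * ξ ^ 2 * ξ⁻¹ ^ 3 * (Real.exp (-(ξ * R / 2)) * (8 * ((hopWeight 3 ξ)⁻¹ * Real.sqrt (π / (rsq y / 14))))
          + Real.exp (-N) * (16 / hopWeight 3 ξ)) := mul_le_mul_of_nonneg_left hI hc
    _ = ξ⁻¹ * (8 * Real.sqrt (14 * π) * (Real.exp (-(ξ * R / 2)) / R) + 16 * Real.exp (-N)) := by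
        rw [hsq]; field_simp
    _ ≤ ξ⁻¹ * (56 * (Real.exp (-(ξ * R / 2)) / R) + 84 * (Real.exp (-(ξ * R / 2)) / R)) := by
        refine mul_le_mul_of_nonneg_left (add_le_add ?_ ?_) (inv_pos.mpr hξ).le
        · exact mul_le_mul_of_nonneg_right (by linarith [h14pi]) (by positivity)
        · have e1 : Real.exp (-N) ≤ Real.exp (-(4 * R / 7)) := Real.exp_le_exp.mpr (by linarith [h47])
          have e2 : Real.exp (-(4 * R / 7)) ≤ 14 / Real.exp 1 * Real.exp (-(R / 2)) / R := by
            rw [le_div_iff₀ hRpos]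
            have := mul_exp_le (R := R)
            linarith
          have e3 : Real.exp (-(R / 2)) ≤ Real.exp (-(ξ * R / 2)) := Real.exp_le_exp.mpr (by nlinarith)
          have e4 : 14 / Real.exp 1 ≤ 21 / 4 := by
            rw [div_le_iff₀ (Real.exp_pos 1)]; linarith [Real.exp_one_gt_d9]
          have e5 : 14 / Real.exp 1 * Real.exp (-(R / 2)) ≤ 21 / 4 * Real.exp (-(ξ * R / 2)) :=
            mul_le_mul e4 e3 (Real.exp_pos _).le (by norm_num)
          have e6 := div_le_div_of_nonneg_right e5 hRpos.le
          calc 16 * Real.exp (-N) ≤ 16 * (14 / Real.exp 1 * Real.exp (-(R / 2)) / R) := by linarith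
            _ ≤ 16 * (21 / 4 * Real.exp (-(ξ * R / 2)) / R) := by linarith
            _ = 84 * (Real.exp (-(ξ * R / 2)) / R) := by ring
    _ = 140 * Real.exp (-(ξ * R / 2)) / (ξ * R) := by ring

/-- kernel: the same bound for |C^ξ(y)| (C^ξ ≥ 0, r15's `B3CxiPropagator.Cxi_nonneg`). [cite: Balaban1983Higgs3, (3.16) p.437] -/
theorem abs_Cxi_three_le (hξ : 0 < ξ) (hξ1 : ξ ≤ 1) (y : ZSite 3) (hy : y ≠ 0) :
    |Cxi 3 ξ y| ≤ 140 * Real.exp (-(ξ * Real.sqrt (∑ μ, ((y μ : ℤ) : ℝ) ^ 2) / 2))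
      / (ξ * Real.sqrt (∑ μ, ((y μ : ℤ) : ℝ) ^ 2)) := by
  rw [abs_of_nonneg (Cxi_nonneg hξ y)]
  exact Cxi_three_le hξ hξ1 y hy

/-- |y|_∞ = max_μ |y_μ| ∈ ℕ, the sup norm of y ∈ ℤ^d (lattice units). [cite: Balaban1983Higgs3, (3.16) p.437] -/
def supNorm (y : ZSite d) : ℕ := Finset.univ.sup fun μ => (y μ).natAbs

/-- kernel: |y_μ| ≤ |y|_∞. [cite: Balaban1983Higgs3, (3.16) p.437] -/
theorem le_supNorm (y : ZSite d) (μ : Fin d) : (y μ).natAbs ≤ supNorm y :=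
  Finset.le_sup (f := fun μ => (y μ).natAbs) (Finset.mem_univ μ)

/-- kernel: the bound in the sup norm (|y|_∞ ≤ |y|): for 0 < ξ ≤ 1 and 0 ≠ y ∈ ℤ³,
C^ξ(y) ≤ 140·e^{−ξ|y|_∞/2}/(ξ|y|_∞) — the shape `A·(ξ·supDist)⁻¹·e^{−δ·ξ·supDist}` (A = 140, δ = ½) used as hypothesis in
`B3Bound316`. [cite: Balaban1983Higgs3, (3.16) p.437] -/
theorem Cxi_three_le_sup (hξ : 0 < ξ) (hξ1 : ξ ≤ 1) (y : ZSite 3) (hy : y ≠ 0) :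
    Cxi 3 ξ y ≤ 140 * Real.exp (-(ξ * supNorm y / 2)) / (ξ * supNorm y) := by
  have h := Cxi_three_le hξ hξ1 y hy
  rw [← rsq_eq] at h
  obtain ⟨μ₀, -, hμ₀⟩ := Finset.exists_mem_eq_sup Finset.univ Finset.univ_nonempty (fun μ => (y μ).natAbs)
  have hsup : supNorm y = (y μ₀).natAbs := hμ₀
  have hmax : ∀ μ, (y μ).natAbs ≤ (y μ₀).natAbs := fun μ => hsup ▸ le_supNorm y μ
  have hN1 : 1 ≤ ((y μ₀).natAbs : ℝ) := one_le_max y hy μ₀ hmax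
  have hNR : ((y μ₀).natAbs : ℝ) ≤ Real.sqrt (rsq y) := by
    refine (Real.le_sqrt (by positivity) (rsq_nonneg y)).mpr ?_
    unfold rsq
    exact Finset.single_le_sum (fun μ _ => sq_nonneg (((y μ).natAbs : ℝ))) (Finset.mem_univ μ₀)
  rw [hsup]
  refine h.trans ?_
  have hξN : 0 < ξ * ((y μ₀).natAbs : ℝ) := mul_pos hξ (by linarith)
  refine div_le_div₀ (by positivity) ?_ hξN (mul_le_mul_of_nonneg_left hNR hξ.le)
  refine mul_le_mul_of_nonneg_left (Real.exp_le_exp.mpr ?_) (by norm_num)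
  have := mul_le_mul_of_nonneg_left hNR hξ.le
  linarith

end

end Literature.MathematicalPhysics.QuantumFieldTheory.Balaban1983to89.B3CxiUniformBound
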